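import Summits.BirchSwinnertonDyer.BirchSwinnertonDyer.Theorems.GenusKolyvaginAtTwoVisiblePairAtTwoCasselsTateHlocCanonical
import HarnessLib

/-!
# Route `CMKolyvaginAtInertTwo`, crux `CMKolyvaginExactAtInertTwo` (stmt-BirchSwinnertonDyer-24277):
# T2 input (iii), local terms — McCallum's Lemma 5.3 discharges `hloc₁/hloc₂_canonical` for an ARBITRARY
# SUPPORT PREDICATE `Kol ≤ kolPrime W K (2L)` and with the kill clause `2^L • t = 0`

Seat `bsd-line-cmk2-p1` g17 (cell `bsd-print-cf2`); helper (`--supports stmt-BirchSwinnertonDyer-24277`).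
THEOREMS ONLY: no definition, no named fact, no `sorry`; no item is closed; BSD is not proved by this.

T2 KIT INTERFACE REPAIR, member side (KERNEL-STATUS-p2-port.md §17). Seat g16's re-based local-term
discharges `hloc₁/hloc₂_canonical_of_rel` (p706978) quantify over gk2's `kolPrime W K (L+L)` (Gross-form
Kolyvagin primes of depth `2L` = the carrier level) and carry the idle binder `2^{2M₀} • t = 0`. The
pair telescope with the kill clause (`card_mul_card_le_two_pow_two_mul_of_injective_of_kill`, this seat)
runs on Kolyvagin primes of depth `2L + 1` (`FrobEqFrobInfty W K (2^{M+1}) ℓ`, `M = 2L`: the LEVEL-CHANGE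
road to the Selmer condition of the descended classes at the ramified prime `q ∣ d_K`, where
`H¹(K_𝔮/ℚ_q, E(K_𝔮)) ≅ E(ℚ_q)[2] = ℤ/2` on `H₂`: `c_{2L}(n) = [2]_* c_{2L+1}(n)` is Selmer at `q`
only for `n` supported on depth-`(2L+1)` primes), and supplies test classes with `2^k • t = 0`, `k ≤ L`.
So the member formulas must accept (a) ANY support predicate `Kol` implying `kolPrime W K (L+L)` (their
hypotheses — Lemma 4.3 over `ℚ`, Prop. 4.4 across — are then asked only on `Kol`-supported levels) and
(b) the clause `2^L • t = 0` in place of `2^{2M₀} • t = 0` (with `M₀ ≤ L` only). This file is p706978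
with exactly these two changes; proofs VERBATIM otherwise (gk2-p2 g12's, re-based by g16; credit there).

* `hloc₁_canonical_of_rel_of_kol`, `hloc₂_canonical_of_rel_of_kol`.

References: [McCallumLMS1991] §4 Prop. 4.4, 4.7, §5 Lemma 5.3, Thm. 5.4 (proof); [MilneADT2006] I §6 Prop. 6.9.
-/

set_option linter.dupNamespace false -- tree convention: `Summit.BirchSwinnertonDyer.BirchSwinnertonDyer.Theorems` (summit = sub-problem)
set_option autoImplicit false

noncomputable section

open scoped Classical
open scoped AddSubgroup

universe u

namespace Summit.BirchSwinnertonDyer.BirchSwinnertonDyer.Theorems.KolyvaginPairDataTwo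

open WeierstrassCurve NumberField IsDedekindDomain Field Function Rat.HeightOneSpectrum
open Literature.NumberTheory.EllipticCurves Literature.NumberTheory.GaloisRepresentations
open Literature.NumberTheory.GaloisCohomology
open Literature.NumberTheory.EllipticCurves.KolyvaginDescent
open Summit.BirchSwinnertonDyer.BirchSwinnertonDyer.Theorems.GenusExact.ReductionCyclic
open Summit.BirchSwinnertonDyer.BirchSwinnertonDyer.Theorems.GenusExact.VisiblePairAtTwo

section Instance

variable {W : WeierstrassCurve ℚ} [W.IsElliptic] [W.IsGloballyMinimal] {K : Type} [Field K] [NumberField K]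
  {L : ℕ}

/-- **`hloc₁` discharged** — McCallum's Lemma 5.3 for the local term at `λ` of the member `E`, in the cochain
currency of `selmer_eq_and_card_selmer_twin_eq_of_localTerms`, for `inv := LocalInvariants.canonical ℚ (2^L · 2^L)`:
from `2^b t ∉ a₁(ℓ)` ⇒ `2^{b+L} β'_ℓ ≠ 0` and `2^{a+j−N} c₂(m') ∉ a₂(ℓ)` ⇒ (Prop. 4.4) `2^{a+L−N} res_ℓ b₁ ∉ 𝓛_ℓ`,
the orders multiply to more than `2^{2L}` and `localTerm_canonical_ne_zero_of_kolPrime` concludes.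
[cite: McCallumLMS1991, §4 Prop. 4.4 and Prop. 4.7, §5 Lemma 5.3, Thm. 5.4 (proof)] [cite: MilneADT2006, Ch. I §6, proof of Prop. 6.9] -/
theorem hloc₁_canonical_of_rel_of_kol [(twin W K).IsElliptic] {M₀ : ℕ} (c₁ : ℕ → galH1Torsion W (lvl (L + L)))
    (c₂ : ℕ → galH1Torsion (twin W K) (lvl (L + L))) (hΔ : W.Δ < 0) (hL : M₀ ≤ L) (hL1 : 1 ≤ L)
    (Kol : ℕ → Prop) (hKol : ∀ ℓ, Kol ℓ → kolPrime W K (L + L) ℓ)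
    -- McCallum's Prop. 4.4 ACROSS the members, odd depth `m'` to even depth `ℓm'` (Selmer at `λ` ↔ twin class vanishes at `λ`)
    (h44₂₁ : ∀ ℓ m : ℕ, Kol ℓ → KolSupp Kol (ℓ * m) →
      Odd m.primeFactors.card → ∀ a : ℕ,
        ((2 : ℤ) ^ a) • c₁ (ℓ * m) ∈ loc₁ W (L + L) (pl ℓ) ↔ ((2 : ℤ) ^ a) • c₂ m ∈ a₂ W K (L + L) ℓ)
    (e : geomTorsion W ((2 ^ L * 2 ^ L : ℕ) : ℤ) → geomTorsion W ((2 ^ L * 2 ^ L : ℕ) : ℤ) → AlgebraicClosure ℚ)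
    (hμ : ∀ S T, e S T ^ (2 ^ L * 2 ^ L) = 1)
    (hadd₁ : ∀ S₁ S₂ T, e (S₁ + S₂) T = e S₁ T * e S₂ T)
    (hadd₂ : ∀ S T₁ T₂, e S (T₁ + T₂) = e S T₁ * e S T₂)
    (hgal : ∀ (σ : absoluteGaloisGroup ℚ) (S T : geomTorsion W ((2 ^ L * 2 ^ L : ℕ) : ℤ)),
      σ • e S T = e (σ • S) (σ • T))
    (halt : ∀ T, e T T = 1) (hnondeg : ∀ T, (∀ S, e S T = 1) → T = 0) :
    ∀ ℓ m' : ℕ, (hℓ : Kol ℓ) → KolSupp Kol (ℓ * m') → ¬ ℓ ∣ m' →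
      Odd m'.primeFactors.card →
      ∀ (j N a b : ℕ) (t : galH1Torsion W (lvl (L + L))), t ∈ selmerGroup W (lvl (L + L)) →
      ((2 : ℤ) ^ j) • c₁ (ℓ * m') ∈ selmerGroup W (lvl (L + L)) →
      ((2 : ℤ) ^ N) • t = 0 → ((2 : ℤ) ^ L) • t = 0 →
      (∀ q ∈ m'.primeFactors, t ∈ a₁ W (L + L) q) → L + L - M₀ ≤ j → N + M₀ ≤ L + L → N ≤ j →
      a + b + 1 = N → ((2 : ℤ) ^ (a + (j - N))) • c₂ m' ∉ a₂ W K (L + L) ℓ →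
      ((2 : ℤ) ^ b) • t ∉ a₁ W (L + L) ℓ →
      ∀ D : FirstCaseData W (2 ^ L),
        D.b₁ = torsionH1OfDvd W (lvl_dvd_sq L) (((2 : ℤ) ^ (j - L)) • c₁ (ℓ * m')) →
        galoisCohomology.map (inclKD W (2 ^ L) (2 ^ L)) 1 D.b' = torsionH1OfDvd W (lvl_dvd_sq L) t →
        D.localTerm e hμ hadd₁ hadd₂ hgal (LocalInvariants.canonical ℚ (2 ^ L * 2 ^ L))
          (Sum.inr (primesEquiv.symm ⟨ℓ, (hKol ℓ hℓ).1⟩)) ≠ 0 := by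
  intro ℓ m' hℓ hsupp _hndvd hodd j N a b t _ht _hz _hN _h2 _hAq hj hNM hNj hab hcm hbt D hD₁ hDt
  have hℓp : ℓ.Prime := (hKol ℓ hℓ).1
  haveI : Fact ℓ.Prime := ⟨hℓp⟩
  haveI : NeZero (2 ^ L) := ⟨pow_ne_zero L two_ne_zero⟩
  haveI : NeZero (2 ^ L * 2 ^ L) := ⟨by positivity⟩
  have hjL : L ≤ j := by omega
  -- ### (Y) `2^{b+L} β'_ℓ ≠ 0`
  have hY : ((2 : ℤ) ^ (b + L)) • D.β' (Sum.inr (primesEquiv.symm ⟨ℓ, hℓp⟩)) ≠ 0 := by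
    intro h0
    apply hbt
    letI : Algebra ℚ (Place.Completion (Sum.inr (primesEquiv.symm ⟨ℓ, hℓp⟩) : Place ℚ)) :=
      Place.instAlgebraCompletion _
    -- `[m]_* (2^b β') = 0` by `ι_* ∘ [m]_* = m` and the injectivity of `ι_*` over `ℚ_ℓ`
    have h1 : galoisCohomology.map ((mulK W (2 ^ L) (2 ^ L)).restrictField
        (Place.Completion (Sum.inr (primesEquiv.symm ⟨ℓ, hℓp⟩) : Place ℚ))) 1
        (((2 : ℤ) ^ b) • D.β' (Sum.inr (primesEquiv.symm ⟨ℓ, hℓp⟩))) = 0 := by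
      apply map_inclKD_restrictField_injective_of_kolPrime hΔ (hKol ℓ hℓ)
      rw [map_zero, map_inclKD_map_mulK_restrictField, smul_smul,
        show (((2 ^ L : ℕ) : ℤ)) * (2 : ℤ) ^ b = (2 : ℤ) ^ (b + L) by push_cast; ring, h0]
    -- `res_ℓ (2^b b') = 0` at level `m`
    have h2 : galoisCohomology.res (W.torsionGaloisModule ((2 ^ L : ℕ) : ℤ))
        (Place.Completion (Sum.inr (primesEquiv.symm ⟨ℓ, hℓp⟩) : Place ℚ)) 1 (((2 : ℤ) ^ b) • D.b') = 0 := by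
      rw [map_zsmul, ← D.map_β' (Sum.inr (primesEquiv.symm ⟨ℓ, hℓp⟩)), ← map_zsmul]
      exact h1
    -- `res_ℓ (ι (2^b t)) = 0` at level `m²`
    have h3 : galoisCohomology.res (W.torsionGaloisModule ((2 ^ L * 2 ^ L : ℕ) : ℤ))
        (Place.Completion (Sum.inr (primesEquiv.symm ⟨ℓ, hℓp⟩) : Place ℚ)) 1
        (torsionH1OfDvd W (lvl_dvd_sq L) (((2 : ℤ) ^ b) • t)) = 0 := by
      have e3 : torsionH1OfDvd W (lvl_dvd_sq L) (((2 : ℤ) ^ b) • t) =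
          galoisCohomology.map (inclKD W (2 ^ L) (2 ^ L)) 1 (((2 : ℤ) ^ b) • D.b') := by
        refine (map_zsmul _ _ _).trans (Eq.trans ?_ (map_zsmul _ _ _).symm)
        exact congrArg (fun z => ((2 : ℤ) ^ b) • z) hDt.symm
      rw [e3, galoisCohomology.res_map_one, h2, map_zero]
    have h4 : torsionH1OfDvd W (lvl_dvd_sq L) (((2 : ℤ) ^ b) • t) ∈
        W.torsionLocalKer (Place.Completion (Sum.inr (primesEquiv.symm ⟨ℓ, hℓp⟩) : Place ℚ))
          ((2 ^ L * 2 ^ L : ℕ) : ℤ) :=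
      (@mem_torsionLocalKer_iff_res_eq_zero ℚ _ W
        (Place.Completion (Sum.inr (primesEquiv.symm ⟨ℓ, hℓp⟩) : Place ℚ)) _ (Place.instAlgebraCompletion _) _ _
        (charZero_placeCompletion _) (2 ^ L * 2 ^ L) (NeZero.ne (2 ^ L * 2 ^ L)) _).mpr h3
    have h5 : ((2 : ℤ) ^ b) • t ∈
        W.torsionLocalKer (Place.Completion (Sum.inr (primesEquiv.symm ⟨ℓ, hℓp⟩) : Place ℚ)) (lvl (L + L)) :=
      (torsionH1OfDvd_mem_torsionLocalKer_iff_of_eq W _ (lvl_dvd_sq L) (lvl_add_eq_sq L) _).mp h4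
    exact (mem_a₁_iff hℓp _).mpr h5
  -- ### the exponents: `b + 1 ≤ L`, else (Y) contradicts `2^{2L} β' = 0`
  by_cases hbL : b + 1 ≤ L
  swap
  · exfalso
    apply hY
    have hkill : (2 ^ L * 2 ^ L) • D.β' (Sum.inr (primesEquiv.symm ⟨ℓ, hℓp⟩)) = 0 :=
      nsmul_continuousCohomology_one_eq_zero _ (2 ^ L * 2 ^ L)
        (fun P : geomTorsion W ((2 ^ L * 2 ^ L : ℕ) : ℤ) => AddSubgroup.torsionBy.nsmul P) _
    have e1 : (2 : ℤ) ^ (b + L) = (2 : ℤ) ^ (b + L - (L + L)) * ((2 ^ L * 2 ^ L : ℕ) : ℤ) := by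
      rw [Nat.cast_mul, Nat.cast_pow, Nat.cast_ofNat, ← pow_add, ← pow_add]
      congr 1
      omega
    rw [e1, mul_smul, natCast_zsmul, hkill, smul_zero]
  -- ### (X) `2^{a+L-N} res_ℓ b₁ ∉ 𝓛_ℓ`, and the generic lemma
  refine localTerm_canonical_ne_zero_of_kolPrime hΔ (hKol ℓ hℓ) (by omega) e hμ hadd₁ hadd₂ hgal halt hnondeg D
    (a := a + L - N) (b := b + L) ?_ hY (by omega)
  intro hmem
  apply hcm
  have epow : ((2 : ℤ) ^ (a + (j - N))) • c₁ (ℓ * m') =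
      ((2 : ℤ) ^ (a + L - N)) • (((2 : ℤ) ^ (j - L)) • c₁ (ℓ * m')) := by
    rw [smul_smul, ← pow_add (2 : ℤ) (a + L - N) (j - L), show a + L - N + (j - L) = a + (j - N) by omega]
  have h6 : torsionH1OfDvd W (lvl_dvd_sq L) (((2 : ℤ) ^ (a + (j - N))) • c₁ (ℓ * m')) ∈
      selmerLocalKer W ((primesEquiv.symm ⟨ℓ, hℓp⟩ : HeightOneSpectrum (𝓞 ℚ)).adicCompletion ℚ)
        ((2 ^ L * 2 ^ L : ℕ) : ℤ) := by
    refine mem_selmerLocalKer_of_mem_kummerLocalConditionAt_res W _ _ ?_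
    rw [epow, map_zsmul (torsionH1OfDvd W (lvl_dvd_sq L)) ((2 : ℤ) ^ (a + L - N)), ← hD₁]
    convert hmem using 1
    exact map_zsmul _ _ _
  have h7 : ((2 : ℤ) ^ (a + (j - N))) • c₁ (ℓ * m') ∈
      selmerLocalKer W ((primesEquiv.symm ⟨ℓ, hℓp⟩ : HeightOneSpectrum (𝓞 ℚ)).adicCompletion ℚ) (lvl (L + L)) :=
    (torsionH1OfDvd_mem_selmerLocalKer_iff W _ (lvl_dvd_sq L) _).mpr h6
  have h8 : ((2 : ℤ) ^ (a + (j - N))) • c₁ (ℓ * m') ∈ loc₁ W (L + L) (pl ℓ) := by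
    rw [pl_of_prime hℓp]; exact h7
  exact (h44₂₁ ℓ m' hℓ hsupp hodd (a + (j - N))).mp h8

/-- **`hloc₂` discharged** — McCallum's Lemma 5.3 for the local term at `λ` of the member `E^{(d_K)}` (the twin), in the cochain
currency of `selmer_eq_and_card_selmer_twin_eq_of_localTerms`, for `inv := LocalInvariants.canonical ℚ (2^L · 2^L)`:
from `2^b t ∉ a₂(ℓ)` ⇒ `2^{b+L} β'_ℓ ≠ 0` and `2^{a+j−N} c₁(m') ∉ a₁(ℓ)` ⇒ (Prop. 4.4) `2^{a+L−N} res_ℓ b₁ ∉ 𝓛_ℓ`,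
the orders multiply to more than `2^{2L}` and `localTerm_canonical_ne_zero_twin_of_kolPrime` concludes.
[cite: McCallumLMS1991, §4 Prop. 4.4 and Prop. 4.7, §5 Lemma 5.3, Thm. 5.4 (proof)] [cite: MilneADT2006, Ch. I §6, proof of Prop. 6.9] -/
theorem hloc₂_canonical_of_rel_of_kol [(twin W K).IsElliptic] {M₀ : ℕ} (c₁ : ℕ → galH1Torsion W (lvl (L + L)))
    (c₂ : ℕ → galH1Torsion (twin W K) (lvl (L + L))) (hK : IsImaginaryQuadratic K)
    (hoddK : Odd (NumberField.discr K)) (hΔ : W.Δ < 0) (hL : M₀ ≤ L) (hL1 : 1 ≤ L)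
    (Kol : ℕ → Prop) (hKol : ∀ ℓ, Kol ℓ → kolPrime W K (L + L) ℓ)
    -- McCallum's Prop. 4.4 ACROSS the members, even depth `m'` to odd depth `ℓm'`
    (h44₁₂ : ∀ ℓ m : ℕ, Kol ℓ → KolSupp Kol (ℓ * m) →
      Even m.primeFactors.card → ∀ a : ℕ,
        ((2 : ℤ) ^ a) • c₂ (ℓ * m) ∈ loc₂ W K (L + L) (pl ℓ) ↔ ((2 : ℤ) ^ a) • c₁ m ∈ a₁ W (L + L) ℓ)
    (e : geomTorsion (twin W K) ((2 ^ L * 2 ^ L : ℕ) : ℤ) → geomTorsion (twin W K) ((2 ^ L * 2 ^ L : ℕ) : ℤ) →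
      AlgebraicClosure ℚ)
    (hμ : ∀ S T, e S T ^ (2 ^ L * 2 ^ L) = 1)
    (hadd₁ : ∀ S₁ S₂ T, e (S₁ + S₂) T = e S₁ T * e S₂ T)
    (hadd₂ : ∀ S T₁ T₂, e S (T₁ + T₂) = e S T₁ * e S T₂)
    (hgal : ∀ (σ : absoluteGaloisGroup ℚ) (S T : geomTorsion (twin W K) ((2 ^ L * 2 ^ L : ℕ) : ℤ)),
      σ • e S T = e (σ • S) (σ • T))
    (halt : ∀ T, e T T = 1) (hnondeg : ∀ T, (∀ S, e S T = 1) → T = 0) :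
    ∀ ℓ m' : ℕ, (hℓ : Kol ℓ) → KolSupp Kol (ℓ * m') → ¬ ℓ ∣ m' →
      Even m'.primeFactors.card →
      ∀ (j N a b : ℕ) (t : galH1Torsion (twin W K) (lvl (L + L))), t ∈ selmerGroup (twin W K) (lvl (L + L)) →
      ((2 : ℤ) ^ j) • c₂ (ℓ * m') ∈ selmerGroup (twin W K) (lvl (L + L)) →
      ((2 : ℤ) ^ N) • t = 0 → ((2 : ℤ) ^ L) • t = 0 →
      (∀ q ∈ m'.primeFactors, t ∈ a₂ W K (L + L) q) → L + L - M₀ ≤ j → N + M₀ ≤ L + L → N ≤ j →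
      a + b + 1 = N → ((2 : ℤ) ^ (a + (j - N))) • c₁ m' ∉ a₁ W (L + L) ℓ →
      ((2 : ℤ) ^ b) • t ∉ a₂ W K (L + L) ℓ →
      ∀ D : FirstCaseData (twin W K) (2 ^ L),
        D.b₁ = torsionH1OfDvd (twin W K) (lvl_dvd_sq L) (((2 : ℤ) ^ (j - L)) • c₂ (ℓ * m')) →
        galoisCohomology.map (inclKD (twin W K) (2 ^ L) (2 ^ L)) 1 D.b' =
          torsionH1OfDvd (twin W K) (lvl_dvd_sq L) t →
        D.localTerm e hμ hadd₁ hadd₂ hgal (LocalInvariants.canonical ℚ (2 ^ L * 2 ^ L))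
          (Sum.inr (primesEquiv.symm ⟨ℓ, (hKol ℓ hℓ).1⟩)) ≠ 0 := by
  intro ℓ m' hℓ hsupp _hndvd heven j N a b t _ht _hz _hN _h2 _hAq hj hNM hNj hab hcm hbt D hD₁ hDt
  have hℓp : ℓ.Prime := (hKol ℓ hℓ).1
  haveI : Fact ℓ.Prime := ⟨hℓp⟩
  haveI : NeZero (2 ^ L) := ⟨pow_ne_zero L two_ne_zero⟩
  haveI : NeZero (2 ^ L * 2 ^ L) := ⟨by positivity⟩
  have hjL : L ≤ j := by omega
  -- ### (Y) `2^{b+L} β'_ℓ ≠ 0`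
  have hY : ((2 : ℤ) ^ (b + L)) • D.β' (Sum.inr (primesEquiv.symm ⟨ℓ, hℓp⟩)) ≠ 0 := by
    intro h0
    apply hbt
    letI : Algebra ℚ (Place.Completion (Sum.inr (primesEquiv.symm ⟨ℓ, hℓp⟩) : Place ℚ)) :=
      Place.instAlgebraCompletion _
    -- `[m]_* (2^b β') = 0` by `ι_* ∘ [m]_* = m` and the injectivity of `ι_*` over `ℚ_ℓ`
    have h1 : galoisCohomology.map ((mulK (twin W K) (2 ^ L) (2 ^ L)).restrictField
        (Place.Completion (Sum.inr (primesEquiv.symm ⟨ℓ, hℓp⟩) : Place ℚ))) 1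
        (((2 : ℤ) ^ b) • D.β' (Sum.inr (primesEquiv.symm ⟨ℓ, hℓp⟩))) = 0 := by
      apply map_inclKD_restrictField_injective_twin_of_kolPrime hK hoddK hΔ (hKol ℓ hℓ)
      rw [map_zero, map_inclKD_map_mulK_restrictField, smul_smul,
        show (((2 ^ L : ℕ) : ℤ)) * (2 : ℤ) ^ b = (2 : ℤ) ^ (b + L) by push_cast; ring, h0]
    -- `res_ℓ (2^b b') = 0` at level `m`
    have h2 : galoisCohomology.res ((twin W K).torsionGaloisModule ((2 ^ L : ℕ) : ℤ))
        (Place.Completion (Sum.inr (primesEquiv.symm ⟨ℓ, hℓp⟩) : Place ℚ)) 1 (((2 : ℤ) ^ b) • D.b') = 0 := by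
      rw [map_zsmul, ← D.map_β' (Sum.inr (primesEquiv.symm ⟨ℓ, hℓp⟩)), ← map_zsmul]
      exact h1
    -- `res_ℓ (ι (2^b t)) = 0` at level `m²`
    have h3 : galoisCohomology.res ((twin W K).torsionGaloisModule ((2 ^ L * 2 ^ L : ℕ) : ℤ))
        (Place.Completion (Sum.inr (primesEquiv.symm ⟨ℓ, hℓp⟩) : Place ℚ)) 1
        (torsionH1OfDvd (twin W K) (lvl_dvd_sq L) (((2 : ℤ) ^ b) • t)) = 0 := by
      have e3 : torsionH1OfDvd (twin W K) (lvl_dvd_sq L) (((2 : ℤ) ^ b) • t) =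
          galoisCohomology.map (inclKD (twin W K) (2 ^ L) (2 ^ L)) 1 (((2 : ℤ) ^ b) • D.b') := by
        refine (map_zsmul _ _ _).trans (Eq.trans ?_ (map_zsmul _ _ _).symm)
        exact congrArg (fun z => ((2 : ℤ) ^ b) • z) hDt.symm
      rw [e3, galoisCohomology.res_map_one, h2, map_zero]
    have h4 : torsionH1OfDvd (twin W K) (lvl_dvd_sq L) (((2 : ℤ) ^ b) • t) ∈
        (twin W K).torsionLocalKer (Place.Completion (Sum.inr (primesEquiv.symm ⟨ℓ, hℓp⟩) : Place ℚ))
          ((2 ^ L * 2 ^ L : ℕ) : ℤ) :=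
      (@mem_torsionLocalKer_iff_res_eq_zero ℚ _ (twin W K)
        (Place.Completion (Sum.inr (primesEquiv.symm ⟨ℓ, hℓp⟩) : Place ℚ)) _ (Place.instAlgebraCompletion _) _ _
        (charZero_placeCompletion _) (2 ^ L * 2 ^ L) (NeZero.ne (2 ^ L * 2 ^ L)) _).mpr h3
    have h5 : ((2 : ℤ) ^ b) • t ∈
        (twin W K).torsionLocalKer (Place.Completion (Sum.inr (primesEquiv.symm ⟨ℓ, hℓp⟩) : Place ℚ))
          (lvl (L + L)) :=
      (torsionH1OfDvd_mem_torsionLocalKer_iff_of_eq (twin W K) _ (lvl_dvd_sq L) (lvl_add_eq_sq L) _).mp h4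
    exact (mem_a₂_iff hℓp _).mpr h5
  -- ### the exponents: `b + 1 ≤ L`, else (Y) contradicts `2^{2L} β' = 0`
  by_cases hbL : b + 1 ≤ L
  swap
  · exfalso
    apply hY
    have hkill : (2 ^ L * 2 ^ L) • D.β' (Sum.inr (primesEquiv.symm ⟨ℓ, hℓp⟩)) = 0 :=
      nsmul_continuousCohomology_one_eq_zero _ (2 ^ L * 2 ^ L)
        (fun P : geomTorsion (twin W K) ((2 ^ L * 2 ^ L : ℕ) : ℤ) => AddSubgroup.torsionBy.nsmul P) _
    have e1 : (2 : ℤ) ^ (b + L) = (2 : ℤ) ^ (b + L - (L + L)) * ((2 ^ L * 2 ^ L : ℕ) : ℤ) := by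
      rw [Nat.cast_mul, Nat.cast_pow, Nat.cast_ofNat, ← pow_add, ← pow_add]
      congr 1
      omega
    rw [e1, mul_smul, natCast_zsmul, hkill, smul_zero]
  -- ### (X) `2^{a+L-N} res_ℓ b₁ ∉ 𝓛_ℓ`, and the generic lemma
  refine localTerm_canonical_ne_zero_twin_of_kolPrime hK hoddK hΔ (hKol ℓ hℓ) (by omega) e hμ hadd₁ hadd₂ hgal halt
    hnondeg D
    (a := a + L - N) (b := b + L) ?_ hY (by omega)
  intro hmem
  apply hcm
  have epow : ((2 : ℤ) ^ (a + (j - N))) • c₂ (ℓ * m') =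
      ((2 : ℤ) ^ (a + L - N)) • (((2 : ℤ) ^ (j - L)) • c₂ (ℓ * m')) := by
    rw [smul_smul, ← pow_add (2 : ℤ) (a + L - N) (j - L), show a + L - N + (j - L) = a + (j - N) by omega]
  have h6 : torsionH1OfDvd (twin W K) (lvl_dvd_sq L) (((2 : ℤ) ^ (a + (j - N))) • c₂ (ℓ * m')) ∈
      selmerLocalKer (twin W K) ((primesEquiv.symm ⟨ℓ, hℓp⟩ : HeightOneSpectrum (𝓞 ℚ)).adicCompletion ℚ)
        ((2 ^ L * 2 ^ L : ℕ) : ℤ) := by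
    refine mem_selmerLocalKer_of_mem_kummerLocalConditionAt_res (twin W K) _ _ ?_
    rw [epow, map_zsmul (torsionH1OfDvd (twin W K) (lvl_dvd_sq L)) ((2 : ℤ) ^ (a + L - N)), ← hD₁]
    convert hmem using 1
    exact map_zsmul _ _ _
  have h7 : ((2 : ℤ) ^ (a + (j - N))) • c₂ (ℓ * m') ∈
      selmerLocalKer (twin W K) ((primesEquiv.symm ⟨ℓ, hℓp⟩ : HeightOneSpectrum (𝓞 ℚ)).adicCompletion ℚ)
        (lvl (L + L)) :=
    (torsionH1OfDvd_mem_selmerLocalKer_iff (twin W K) _ (lvl_dvd_sq L) _).mpr h6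
  have h8 : ((2 : ℤ) ^ (a + (j - N))) • c₂ (ℓ * m') ∈ loc₂ W K (L + L) (pl ℓ) := by
    rw [pl_of_prime hℓp]; exact h7
  exact (h44₁₂ ℓ m' hℓ hsupp heven (a + (j - N))).mp h8

end Instance

end Summit.BirchSwinnertonDyer.BirchSwinnertonDyer.Theorems.KolyvaginPairDataTwo

end
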